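import Mathlib
import Literature.MathematicalPhysics.QuantumFieldTheory.Balaban1983to89.B9Eq325Proj

/-! # `Balaban1983to89.B9Eq320Gauss` — B9 pp. 393–394, (3.17) → (3.20): the Gaussian λ-integral of the gauge-fixing
density, "calculated in the same way as in [3]" — kernel-checked (translation invariance + the (3.22) split)

CITATION HEADER.  Paper sub-cell `b2b-balaban-b09` (gen 6, journal claim SHARPEN T06.1 setup (3.17)→(3.20) Gaussian
step pass 8 ∕ C-B9-29-GAUSS, cell pub-balaban) on T. Balaban, *Propagators for lattice gauge theories in a background
field*, Commun. Math. Phys. 99 (1985) 389–434 [`Balaban1985BackgroundPropagators`] (= B9), Sect. 3 set-up, pp. 393–394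
[PDF 5–6] (renders `b2b-balaban-ref1/pages/1985-cmp99-background-propagators/…-p005-x2.png`, `…-p006-x2.png`), and on
[3] = T. Bałaban, *Propagators and renormalization transformations for lattice gauge theories. I*, Commun. Math. Phys.
95 (1984) 17–40 [`Balaban1984PropagatorsI`] (= B5), pp. 22, 24, 25 [PDF 6, 8, 9] (renders
`…/1984-cmp95-propagators-rt-I/…-p006-x2.png`, `…-p008-x2.png`, `…-p009-x2.png`); all five pages read as images this
session.

WHAT IS PRINTED (verbatim).
* B9 p. 393: *"Let us recall that the configuration U′ = e^{iηA} transforms by the formula (55) in [5] under a gauge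
  transformation u, …, and if u = e^{iλ}, then the part of this transformation linear in A and λ is given by
  A^λ = A − Dλ. We define a gauge fixing density by the expression
  exp(−(1/2α)‖D\*A‖²)(Z′^{−1}∫dλ δ(Q′λ)exp(−(1/2α)‖D\*A^λ‖²))^{−1}, (3.17) where Q′λ is defined on 𝔅 = ⋃_{j=0}^{k}Λ_j
  by the formulas (3.18) …"*; *"The norm ‖·‖ in (3.17) is determined by the scalar product ⟨λ, λ′⟩ = Σ_{x∈Ω₀} η^d
  tr λ(x)λ′(x) in the Hilbert space L²(Ω₀, 𝔤)."*  (Z′ is not given a displayed formula on pp. 391–394.)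
* B9 p. 394: *"The integral in (3.17) can be calculated in the same way as in [3], (1.42)–(1.44), and we get
  (3.17) = exp(−(1/2α)‖RD\*A‖²), (3.20) where R = R(U) is an orthogonal projection in the Hilbert space L²(Ω₀, 𝔤) onto
  the subspace R = Δ^η_U N(Q′), N(Q′) = {λ : Q′λ = 0}. (3.21) For an arbitrary function f∈L²(Ω₀, 𝔤) we have Rf = Δ^η_U λ₀,
  where λ₀ is a minimum of the function λ∈N(Q′), λ → ‖f − Δ^η_U λ‖². (3.22) In the above formulas Δ_U is the covariant
  Laplce operator Δ^η_U = D^η\*_U D^η_U"* (3.23).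
* B5 p. 22, (1.27)–(1.28): *"We have finally exp(−(1/2α)⟨∂\*A, ∂\*A⟩)(∫dλδ(Q′_kλ)exp(−(1/2α)⟨∂\*A^λ, ∂\*A^λ⟩))^{−1}
  = (∫dλδ(Q′_kλ)exp(−(1/2α)‖Δλ‖²))^{−1} exp[−(1/2α)⟨∂\*A, (I − Δ^{−1}Q′\*_k(Q′_kΔ^{−2}Q′\*_k)^{−1}Q′_kΔ^{−1})∂\*A⟩].
  (1.27) It is easy to verify that the operator I − … is a projection in the space L²(T_η) of scalar functions, so we
  can write also (1.27) = (∫dλδ(Q′_kλ)exp(−(1/2α)‖Δλ‖²))^{−1}·exp[−(1/2α)‖(I − …)∂\*A‖²]. (1.28)"*;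
  B5 p. 24, (1.39): *"The gauge fixing density has the form 𝒢_α(∂\*A) = (∫dλ δ(Q′_kλ) exp(−(1/2α)‖Δλ‖²))^{−1}
  exp(−(1/2α)‖R∂\*A‖²), (1.39)"*; B5 p. 25: *"and from its definition it follows that ∫dλ δ(Q′_kλ)𝒢_α(∂\*A^λ) = 1."*,
  (1.40): *"∫dλ δ(Q′_kλ) exp(−(1/2α)‖Δλ‖²) = ∫_{N(Q′_k)} dλ exp(−(1/2α)‖Δλ‖²) = …"*, and (1.42): *"(1.24) = ∫dλ δ(Q′_kλ)
  exp(−(1/2α)‖∂\*A − Δλ − aQ′\*_kQ′_kλ‖²), (1.42) … We repeat the calculations done after the formula (1.24) with the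
  operator Δ′_a instead of Δ and we get the following formulas for the minimizing function λ₀, (1.43) and for the
  projection operator R (1.44)."*

WHAT WAS ALREADY KERNEL-CHECKED, AND WHAT WAS NOT.  `B9Eq325Proj` (pass 6) certifies (3.21), (3.22), (3.25) and the
exponent bookkeeping `norm_sq_320` ‖f‖² = ‖f − Rf‖² + ‖Rf‖², `norm_sq_split_322` ‖f − Δ^η_U λ‖² = ‖Δ^η_U(λ₀ − λ)‖² + ‖f − Rf‖²
(λ ∈ N(Q′)), and says verbatim: "The Gaussian λ-integral itself (…; Z′) is NOT reproduced".  On the B5 side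
`B5Projection127` / `B5Infimum124` state "(no integration is typed)".  `B9H163.h164_mean` (adv1) integrates, but a
different object: the Gaussian MEAN of (3.164), p. 429.  THIS FILE types the λ-INTEGRAL of (3.17) and certifies the
sentence "(3.17) = exp(−(1/2α)‖RD\*A‖²), (3.20)".

TYPING.  `E`, `F`, `Δ` = Δ^η_U↾Ω₀, `q` = Q′, `qs` = Q′\*, `A` = a, `g` = G′, `c` = (Q′G′²Q′\*)^{−1}, `R325`, `lam0`, and the
hypothesis bundle `Data Δ q qs A g c` exactly as in `B9Eq325Proj` (see its header).  NEW here: the measure "dλ δ(Q′λ)".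
B5 (1.40) prints the reading *"∫dλ δ(Q′_kλ)(…) = ∫_{N(Q′_k)} dλ (…)"* — the translation-invariant (Lebesgue) measure of the
linear subspace N(Q′).  We type it as: a parameter space `W` (a real normed space with its Borel σ-algebra), a measure
`μ` on `W` that is invariant under right translations (`μ.IsAddRightInvariant`; every additive Haar measure on a
finite-dimensional space is), and a linear parametrisation `ι : W →ₗ[ℝ] E` of N(Q′): `Q′ι = 0` (`hι`) and ι is ONTO
N(Q′) (`hι'`).  With f := D\*A ∈ E and D\*A^λ = D\*A − D\*Dλ = f − Δ^η_U λ ((3.23)), the integral of (3.17) is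
`sliceInt Δ ι μ α f = ∫ exp(−(1/2α)‖f − Δ^η_U ιw‖²) dμ(w)`; `Z0` is its value at f = 0, i.e. B5's prefactor integral
∫dλ δ(Q′λ) exp(−(1/2α)‖Δ^η_U λ‖²) of (1.28)/(1.39)/(1.40); `density … Z' f` is the expression (3.17) with a normalisation
constant Z′ left FREE (B9 displays no formula for Z′ on these pages).  Mathlib's Bochner integral returns 0 on
non-integrable input; NO integrability hypothesis is needed anywhere below (translation invariance and constant
factors commute with `∫` unconditionally), and where a non-vanishing is needed it is the explicit hypothesis Z0 ≠ 0 —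
which (3.17) itself presupposes by writing Z′^{−1} and (…)^{−1}.

WHAT THIS FILE CERTIFIES (kernel, zero sorry; value = the printed sentence "(3.17) = exp(−(1/2α)‖RD\*A‖²), (3.20)" and
B5's (1.27) = (1.28) = (1.39) integral step settled at this abstraction, NOT summit progress).
1. `sliceInt_eq` — THE GAUSSIAN STEP: ∫dλ δ(Q′λ) exp(−(1/2α)‖f − Δ^η_U λ‖²) = exp(−(1/2α)‖f − Rf‖²) · Z0, for every f, by the
   (3.22) split at λ₀ (`norm_sq_split_322`) and the translation λ → λ₀ + λ inside N(Q′) (`integral_sub_right_eq_self`).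
   This is "the same way as in [3]": B5's (1.27) first equality / the (1.42) route, with Δ′_a for Δ already absorbed in
   pass 6 (`Data.greenData`, a-independence `R325_indep`).
2. `density_eq` — (3.17) with a free Z′ equals (Z′/Z0)·exp(−(1/2α)‖Rf‖²) (item 1 + `norm_sq_320`); hence `density_320`:
   for Z′ = Z0, (3.17) = exp(−(1/2α)‖RD\*A‖²) — the printed (3.20) — and `Z'_eq_of_320` / `density_320_iff`: (3.20) as
   printed (no prefactor) holds for some f iff Z′ = Z0 = ∫dλ δ(Q′λ) exp(−(1/2α)‖Δ^η_U λ‖²) — so the undisplayed Z′ of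
   (3.17) is DETERMINED by (3.20) and is B5's (1.39) prefactor integral (located remark, not a gap).
3. `density_139` — B5's unnormalised form (1.27) = (1.28) = (1.39): exp(−(1/2α)‖f‖²)(∫…)^{−1} = Z0^{−1}·exp(−(1/2α)‖Rf‖²).
4. `sliceInt_sub_lap`, `fp_normalisation` — the λ-integral is invariant under f → f − Δ^η_U ιw₁ (A → A^{λ₁}, λ₁ ∈ N(Q′)),
   and the Faddeev–Popov identity behind B5 p. 25 *"from its definition it follows that ∫dλ δ(Q′_kλ)𝒢_α(∂\*A^λ) = 1"*:
   ∫dμ(w′) density(Z′)(f − Δ^η_U ιw′) = Z′ (so = 1 for B5's 𝒢_α, which is `density` with Z′ = 1) — from translation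
   invariance ALONE (no `Data`, no surjectivity of ι), exactly as "from its definition" says.
NOT HERE: the lattice realisation (E = L²(Ω₀, 𝔤) with the η^d tr-weighted product, N(Q′) ⊂ E, its Lebesgue measure —
any right-invariant μ and any onto parametrisation ι are allowed, which only generalises); Z0 > 0 / finiteness of the
Gaussian integral (it is the hypothesis `Z0 ≠ 0` where used); Theorem 3.11; everything after (3.25).  Elementary;
[folklore] on the calculus, [cite:] on the transcribed formulas.  Cell records: GAPS C-B9-29, DIVERGENCE D-b09.20. -/

namespace Literature.MathematicalPhysics.QuantumFieldTheory.Balaban1983to89.B9Eq320Gauss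

open MeasureTheory B5Projector144 B9Eq325Proj

variable {E F W : Type*} [NormedAddCommGroup E] [InnerProductSpace ℝ E] [NormedAddCommGroup F]
  [InnerProductSpace ℝ F] [NormedAddCommGroup W] [NormedSpace ℝ W] [MeasurableSpace W]

/-! ## §1  The printed objects -/

/-- The λ-integral of **(3.17)**: "∫dλ δ(Q′λ) exp(−(1/2α)‖D\*A^λ‖²)" with f = D\*A, D\*A^λ = f − Δ^η_U λ ((3.23)), the
δ-function measure read as in B5 (1.40) (*"= ∫_{N(Q′_k)} dλ …"*): a right-translation-invariant measure `μ` on a parameter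
space `W` of N(Q′), parametrised by `ι`. [cite: Balaban1985BackgroundPropagators, (3.17) p.393;
Balaban1984PropagatorsI, (1.40) p.25] -/
noncomputable def sliceInt (Δ : E →ₗ[ℝ] E) (ι : W →ₗ[ℝ] E) (μ : Measure W) (α : ℝ) (f : E) : ℝ :=
  ∫ w, Real.exp (-(1 / (2 * α)) * ‖f - Δ (ι w)‖ ^ 2) ∂μ

/-- Unfolding lemma for `sliceInt`. [folklore] -/
theorem sliceInt_apply (Δ : E →ₗ[ℝ] E) (ι : W →ₗ[ℝ] E) (μ : Measure W) (α : ℝ) (f : E) :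
    sliceInt Δ ι μ α f = ∫ w, Real.exp (-(1 / (2 * α)) * ‖f - Δ (ι w)‖ ^ 2) ∂μ := rfl

/-- The value at f = 0 (A = 0): Z0 = ∫dλ δ(Q′λ) exp(−(1/2α)‖Δ^η_U λ‖²) — B5's prefactor integral of (1.28)/(1.39)/(1.40),
and (item 2 of the header) the only value of Z′ compatible with the printed (3.20).
[cite: Balaban1984PropagatorsI, (1.39) p.24, (1.40) p.25] -/
noncomputable def Z0 (Δ : E →ₗ[ℝ] E) (ι : W →ₗ[ℝ] E) (μ : Measure W) (α : ℝ) : ℝ :=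
  sliceInt Δ ι μ α 0

/-- Z0 = ∫dλ δ(Q′λ) exp(−(1/2α)‖Δ^η_U λ‖²) (B5 (1.39)/(1.40) prefactor integral).
[cite: Balaban1984PropagatorsI, (1.40) p.25] -/
theorem Z0_eq (Δ : E →ₗ[ℝ] E) (ι : W →ₗ[ℝ] E) (μ : Measure W) (α : ℝ) :
    Z0 Δ ι μ α = ∫ w, Real.exp (-(1 / (2 * α)) * ‖Δ (ι w)‖ ^ 2) ∂μ := by
  unfold Z0 sliceInt
  congr 1
  funext w
  rw [zero_sub, norm_neg]

/-- The gauge-fixing density **(3.17)** as a function of f = D\*A, with the normalisation constant Z′ left free: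
exp(−(1/2α)‖f‖²)·(Z′^{−1}∫dλ δ(Q′λ) exp(−(1/2α)‖f − Δ^η_U λ‖²))^{−1}.  (B5's 𝒢_α of (1.27)/(1.39) is the case Z′ = 1.)
[cite: Balaban1985BackgroundPropagators, (3.17) p.393; Balaban1984PropagatorsI, (1.27) p.22] -/
noncomputable def density (Δ : E →ₗ[ℝ] E) (ι : W →ₗ[ℝ] E) (μ : Measure W) (α Z' : ℝ) (f : E) : ℝ :=
  Real.exp (-(1 / (2 * α)) * ‖f‖ ^ 2) * (Z'⁻¹ * sliceInt Δ ι μ α f)⁻¹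

/-- Unfolding lemma for `density` (the expression (3.17)). [cite: Balaban1985BackgroundPropagators, (3.17) p.393] -/
theorem density_apply (Δ : E →ₗ[ℝ] E) (ι : W →ₗ[ℝ] E) (μ : Measure W) (α Z' : ℝ) (f : E) :
    density Δ ι μ α Z' f = Real.exp (-(1 / (2 * α)) * ‖f‖ ^ 2) * (Z'⁻¹ * sliceInt Δ ι μ α f)⁻¹ := rfl

/-- Z0 ≥ 0 (an integral of a positive function; it is 0 exactly when Mathlib's `∫` meets a non-integrable Gaussian or
μ = 0 — the printed text presupposes neither, writing Z′^{−1}). [folklore] -/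
theorem Z0_nonneg (Δ : E →ₗ[ℝ] E) (ι : W →ₗ[ℝ] E) (μ : Measure W) (α : ℝ) : 0 ≤ Z0 Δ ι μ α := by
  rw [Z0_eq]
  exact integral_nonneg fun _ => (Real.exp_pos _).le

/-- The λ-integral of (3.17) is ≥ 0 for every f. [folklore] -/
theorem sliceInt_nonneg (Δ : E →ₗ[ℝ] E) (ι : W →ₗ[ℝ] E) (μ : Measure W) (α : ℝ) (f : E) :
    0 ≤ sliceInt Δ ι μ α f :=
  integral_nonneg fun _ => (Real.exp_pos _).le

/-! ## §2  Translation invariance: the λ-integral does not see A → A^{λ₁}, and the Faddeev–Popov identity -/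

section Invariance

variable [BorelSpace W] (Δ : E →ₗ[ℝ] E) (ι : W →ₗ[ℝ] E) (μ : Measure W) [μ.IsAddRightInvariant] (α : ℝ)

/-- GAUGE INVARIANCE OF THE λ-INTEGRAL: replacing f = D\*A by D\*A^{λ₁} = f − Δ^η_U λ₁ with λ₁ = ιw₁ ∈ N(Q′) does not change
∫dλ δ(Q′λ) exp(−(1/2α)‖f − Δ^η_U λ‖²) (translation λ → λ + λ₁ of the invariant measure). [folklore] -/
theorem sliceInt_sub_lap (f : E) (w₁ : W) : sliceInt Δ ι μ α (f - Δ (ι w₁)) = sliceInt Δ ι μ α f := by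
  unfold sliceInt
  have hfun : (fun w => Real.exp (-(1 / (2 * α)) * ‖f - Δ (ι w₁) - Δ (ι w)‖ ^ 2))
      = fun w => Real.exp (-(1 / (2 * α)) * ‖f - Δ (ι (w + w₁))‖ ^ 2) := by
    funext w
    rw [map_add, map_add, sub_sub, add_comm (Δ (ι w₁))]
  rw [hfun]
  exact integral_add_right_eq_self (fun w => Real.exp (-(1 / (2 * α)) * ‖f - Δ (ι w)‖ ^ 2)) w₁

/-- `sliceInt_sub_lap` with the opposite sign: f → f + Δ^η_U ιw₁ does not change the λ-integral. [folklore] -/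
theorem sliceInt_add_lap (f : E) (w₁ : W) : sliceInt Δ ι μ α (f + Δ (ι w₁)) = sliceInt Δ ι μ α f := by
  have h := sliceInt_sub_lap Δ ι μ α f (-w₁)
  rwa [map_neg, map_neg, sub_neg_eq_add] at h

/-- The density (3.17) along a gauge orbit: density(f − Δ^η_U ιw′) = exp(−(1/2α)‖f − Δ^η_U ιw′‖²)·(Z′^{−1}·sliceInt f)^{−1} —
the second factor is CONSTANT on the orbit. [folklore] -/
theorem density_sub_lap (Z' : ℝ) (f : E) (w' : W) :
    density Δ ι μ α Z' (f - Δ (ι w'))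
      = Real.exp (-(1 / (2 * α)) * ‖f - Δ (ι w')‖ ^ 2) * (Z'⁻¹ * sliceInt Δ ι μ α f)⁻¹ := by
  rw [density_apply, sliceInt_sub_lap]

/-- THE FADDEEV–POPOV IDENTITY "from its definition": ∫dμ(w′) density_{Z′}(f − Δ^η_U ιw′) = Z′ whenever the λ-integral of
f is non-zero — B5 p. 25 *"from its definition it follows that ∫dλ δ(Q′_kλ)𝒢_α(∂\*A^λ) = 1"* is the case Z′ = 1.  Uses
ONLY the translation invariance of dλ (no projection formula, no surjectivity of ι).
[cite: Balaban1984PropagatorsI, p.25 (sentence before (1.40))] -/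
theorem fp_normalisation (Z' : ℝ) (f : E) (hf : sliceInt Δ ι μ α f ≠ 0) :
    ∫ w', density Δ ι μ α Z' (f - Δ (ι w')) ∂μ = Z' := by
  have hfun : (fun w' => density Δ ι μ α Z' (f - Δ (ι w')))
      = fun w' => Real.exp (-(1 / (2 * α)) * ‖f - Δ (ι w')‖ ^ 2) * (Z'⁻¹ * sliceInt Δ ι μ α f)⁻¹ := by
    funext w'
    exact density_sub_lap Δ ι μ α Z' f w'
  rw [hfun, integral_mul_const, ← sliceInt_apply Δ ι μ α f, mul_inv, inv_inv, ← mul_assoc, mul_comm (sliceInt Δ ι μ α f),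
    mul_assoc, mul_inv_cancel₀ hf, mul_one]

/-- B5's normalisation literally: with Z′ = 1 (𝒢_α of (1.27)/(1.39)), ∫dλ δ(Q′_kλ)𝒢_α(∂\*A^λ) = 1.
[cite: Balaban1984PropagatorsI, p.25] -/
theorem fp_normalisation_one (f : E) (hf : sliceInt Δ ι μ α f ≠ 0) :
    ∫ w', density Δ ι μ α 1 (f - Δ (ι w')) ∂μ = 1 :=
  fp_normalisation Δ ι μ α 1 f hf

end Invariance

/-! ## §3  The Gaussian step (3.17) → (3.20) -/

section Alg

variable {Δ : E →ₗ[ℝ] E} {q : E →ₗ[ℝ] F} {qs : F →ₗ[ℝ] E} {A : F →ₗ[ℝ] F} {g : E →ₗ[ℝ] E} {c : F →ₗ[ℝ] F}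
  (h : Data Δ q qs A g c) (α : ℝ)

include h

/-- (3.20)'s two exponents combined (pass 6, `norm_sq_320`) in exponential form:
exp(−(1/2α)‖f‖²) = exp(−(1/2α)‖f − Rf‖²)·exp(−(1/2α)‖Rf‖²). [cite: Balaban1985BackgroundPropagators, (3.20) p.394] -/
theorem exp_split_320 (f : E) :
    Real.exp (-(1 / (2 * α)) * ‖f‖ ^ 2)
      = Real.exp (-(1 / (2 * α)) * ‖f - R325 q qs g c f‖ ^ 2) * Real.exp (-(1 / (2 * α)) * ‖R325 q qs g c f‖ ^ 2) := by
  rw [← Real.exp_add, h.norm_sq_320 f]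
  congr 1
  ring

/-- a-INDEPENDENCE of the whole computation: the value exp(−(1/2α)‖Rf‖²) of (3.20) does not depend on the auxiliary
(a, G′, (Q′G′²Q′\*)^{−1}) — any two `Data` over the same Δ^η_U, Q′ give the same density (pass 6 `R325_indep`).
[cite: Balaban1985BackgroundPropagators, (3.20)-(3.21) p.394] -/
theorem density_indep {A₂ : F →ₗ[ℝ] F} {g₂ : E →ₗ[ℝ] E} {c₂ : F →ₗ[ℝ] F} (h₂ : Data Δ q qs A₂ g₂ c₂) (f : E) :
    Real.exp (-(1 / (2 * α)) * ‖R325 q qs g c f‖ ^ 2) = Real.exp (-(1 / (2 * α)) * ‖R325 q qs g₂ c₂ f‖ ^ 2) := by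
  rw [h.R325_indep h₂]

end Alg

section Gauss

variable [BorelSpace W] {Δ : E →ₗ[ℝ] E} {q : E →ₗ[ℝ] F} {qs : F →ₗ[ℝ] E} {A : F →ₗ[ℝ] F} {g : E →ₗ[ℝ] E}
  {c : F →ₗ[ℝ] F} {ι : W →ₗ[ℝ] E} (h : Data Δ q qs A g c) (hι : ∀ w, q (ι w) = 0)
  (hι' : ∀ l, q l = 0 → ∃ w, ι w = l) (μ : Measure W) [μ.IsAddRightInvariant] (α : ℝ)

include h hι hι'

/-- **THE GAUSSIAN STEP behind (3.20)** ("calculated in the same way as in [3]"; B5 (1.27), first equality):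
∫dλ δ(Q′λ) exp(−(1/2α)‖f − Δ^η_U λ‖²) = exp(−(1/2α)‖f − Rf‖²) · ∫dλ δ(Q′λ) exp(−(1/2α)‖Δ^η_U λ‖²), for EVERY f: split the
exponent at the (3.22) minimiser λ₀ ∈ N(Q′) (`norm_sq_split_322`) and translate λ → λ₀ + λ inside N(Q′).  No
integrability is needed. [cite: Balaban1985BackgroundPropagators, (3.20) p.394; Balaban1984PropagatorsI, (1.27) p.22] -/
theorem sliceInt_eq (f : E) :
    sliceInt Δ ι μ α f = Real.exp (-(1 / (2 * α)) * ‖f - R325 q qs g c f‖ ^ 2) * Z0 Δ ι μ α := by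
  obtain ⟨w₀, hw₀⟩ := hι' (lam0 q qs g c f) (h.q_lam0 f)
  have key : ∀ w, ‖f - Δ (ι w)‖ ^ 2 = ‖Δ (ι (w - w₀))‖ ^ 2 + ‖f - R325 q qs g c f‖ ^ 2 := by
    intro w
    have h1 := h.norm_sq_split_322 f (ι w) (hι w)
    have h2 : lam0 q qs g c f - ι w = -(ι (w - w₀)) := by rw [← hw₀, map_sub, neg_sub]
    rw [h1, h2, map_neg, norm_neg]
  have hfun : (fun w => Real.exp (-(1 / (2 * α)) * ‖f - Δ (ι w)‖ ^ 2))
      = fun w => Real.exp (-(1 / (2 * α)) * ‖f - R325 q qs g c f‖ ^ 2)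
          * Real.exp (-(1 / (2 * α)) * ‖Δ (ι (w - w₀))‖ ^ 2) := by
    funext w
    rw [key w, mul_add, add_comm, Real.exp_add]
  have hI : ∫ w, Real.exp (-(1 / (2 * α)) * ‖Δ (ι (w - w₀))‖ ^ 2) ∂μ
      = ∫ w, Real.exp (-(1 / (2 * α)) * ‖Δ (ι w)‖ ^ 2) ∂μ :=
    integral_sub_right_eq_self (fun w => Real.exp (-(1 / (2 * α)) * ‖Δ (ι w)‖ ^ 2)) w₀
  rw [sliceInt_apply, hfun, integral_const_mul, hI, Z0_eq]

/-- The λ-integral vanishes for one f iff it vanishes at f = 0 (the exponential factor is positive): the single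
non-degeneracy condition is Z0 ≠ 0. [folklore] -/
theorem sliceInt_ne_zero_iff (f : E) : sliceInt Δ ι μ α f ≠ 0 ↔ Z0 Δ ι μ α ≠ 0 := by
  rw [sliceInt_eq h hι hι' μ α f, mul_ne_zero_iff]
  exact ⟨fun hh => hh.2, fun hh => ⟨(Real.exp_pos _).ne', hh⟩⟩

/-- **(3.17) EVALUATED, Z′ free**: exp(−(1/2α)‖f‖²)(Z′^{−1}∫dλ δ(Q′λ)exp(−(1/2α)‖f − Δ^η_U λ‖²))^{−1} = (Z′/Z0)·exp(−(1/2α)‖Rf‖²).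
(Unconditional: if Z0 = 0 or Z′ = 0 both sides are 0 by Mathlib's 0⁻¹ = 0.)
[cite: Balaban1985BackgroundPropagators, (3.17) p.393, (3.20) p.394] -/
theorem density_eq (Z' : ℝ) (f : E) :
    density Δ ι μ α Z' f = Z' / Z0 Δ ι μ α * Real.exp (-(1 / (2 * α)) * ‖R325 q qs g c f‖ ^ 2) := by
  have he : Real.exp (-(1 / (2 * α)) * ‖f - R325 q qs g c f‖ ^ 2) ≠ 0 := (Real.exp_pos _).ne'
  rw [density_apply, sliceInt_eq h hι hι' μ α f, exp_split_320 h α f, mul_inv, inv_inv, mul_inv,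
    div_eq_mul_inv]
  calc Real.exp (-(1 / (2 * α)) * ‖f - R325 q qs g c f‖ ^ 2) * Real.exp (-(1 / (2 * α)) * ‖R325 q qs g c f‖ ^ 2)
        * (Z' * ((Real.exp (-(1 / (2 * α)) * ‖f - R325 q qs g c f‖ ^ 2))⁻¹ * (Z0 Δ ι μ α)⁻¹))
      = (Real.exp (-(1 / (2 * α)) * ‖f - R325 q qs g c f‖ ^ 2)
          * (Real.exp (-(1 / (2 * α)) * ‖f - R325 q qs g c f‖ ^ 2))⁻¹)
          * (Z' * (Z0 Δ ι μ α)⁻¹ * Real.exp (-(1 / (2 * α)) * ‖R325 q qs g c f‖ ^ 2)) := by ring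
    _ = Z' * (Z0 Δ ι μ α)⁻¹ * Real.exp (-(1 / (2 * α)) * ‖R325 q qs g c f‖ ^ 2) := by
      rw [mul_inv_cancel₀ he, one_mul]

/-- **(3.20) AS PRINTED**: with Z′ = Z0 = ∫dλ δ(Q′λ) exp(−(1/2α)‖Δ^η_U λ‖²) (≠ 0), (3.17) = exp(−(1/2α)‖RD\*A‖²).
[cite: Balaban1985BackgroundPropagators, (3.20) p.394] -/
theorem density_320 (hZ : Z0 Δ ι μ α ≠ 0) (f : E) :
    density Δ ι μ α (Z0 Δ ι μ α) f = Real.exp (-(1 / (2 * α)) * ‖R325 q qs g c f‖ ^ 2) := by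
  rw [density_eq h hι hι' μ α, div_self hZ, one_mul]

/-- Z′ IS DETERMINED BY (3.20): if the printed identity (3.17) = exp(−(1/2α)‖Rf‖²) holds for ONE f (and Z0 ≠ 0), then
Z′ = Z0 — the undisplayed normalisation of (3.17) is B5's (1.39) prefactor integral (located remark).
[cite: Balaban1985BackgroundPropagators, (3.17) p.393, (3.20) p.394; Balaban1984PropagatorsI, (1.39) p.24] -/
theorem Z'_eq_of_320 (hZ : Z0 Δ ι μ α ≠ 0) (Z' : ℝ) (f : E)
    (h320 : density Δ ι μ α Z' f = Real.exp (-(1 / (2 * α)) * ‖R325 q qs g c f‖ ^ 2)) : Z' = Z0 Δ ι μ α := by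
  have he : Real.exp (-(1 / (2 * α)) * ‖R325 q qs g c f‖ ^ 2) ≠ 0 := (Real.exp_pos _).ne'
  rw [density_eq h hι hι' μ α Z' f] at h320
  have h1 : Z' / Z0 Δ ι μ α = 1 := by
    have := mul_right_cancel₀ he (h320.trans (one_mul _).symm)
    exact this
  rwa [div_eq_one_iff_eq hZ] at h1

/-- (3.20) as printed holds (for a given f, equivalently for all f) iff Z′ = Z0. [folklore] -/
theorem density_320_iff (hZ : Z0 Δ ι μ α ≠ 0) (Z' : ℝ) (f : E) :
    density Δ ι μ α Z' f = Real.exp (-(1 / (2 * α)) * ‖R325 q qs g c f‖ ^ 2) ↔ Z' = Z0 Δ ι μ α :=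
  ⟨Z'_eq_of_320 h hι hι' μ α hZ Z' f, fun hZ' => by rw [hZ', density_320 h hι hι' μ α hZ]⟩

/-- **B5 (1.27) = (1.28) = (1.39)** (the unnormalised form): exp(−(1/2α)‖f‖²)(∫dλ δ(Q′λ)exp(−(1/2α)‖f − Δλ‖²))^{−1}
= (∫dλ δ(Q′λ)exp(−(1/2α)‖Δλ‖²))^{−1}·exp(−(1/2α)‖Rf‖²).  (Unconditional.)
[cite: Balaban1984PropagatorsI, (1.27)-(1.28) p.22, (1.39) p.24] -/
theorem density_139 (f : E) :
    Real.exp (-(1 / (2 * α)) * ‖f‖ ^ 2) * (sliceInt Δ ι μ α f)⁻¹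
      = (Z0 Δ ι μ α)⁻¹ * Real.exp (-(1 / (2 * α)) * ‖R325 q qs g c f‖ ^ 2) := by
  have h1 := density_eq h hι hι' μ α 1 f
  rwa [density_apply, inv_one, one_mul, one_div (Z0 Δ ι μ α)] at h1

/-- The Faddeev–Popov identity of §2 under the set-up hypotheses: ∫dμ(w′) density_{Z′}(f − Δ^η_U ιw′) = Z′ for EVERY f as
soon as Z0 ≠ 0; in particular for the (3.20)-normalisation Z′ = Z0 the gauge-orbit integral of (3.17) is Z0.
[cite: Balaban1984PropagatorsI, p.25; Balaban1985BackgroundPropagators, (3.17) p.393] -/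
theorem fp_normalisation' (hZ : Z0 Δ ι μ α ≠ 0) (Z' : ℝ) (f : E) :
    ∫ w', density Δ ι μ α Z' (f - Δ (ι w')) ∂μ = Z' :=
  fp_normalisation Δ ι μ α Z' f ((sliceInt_ne_zero_iff h hι hι' μ α f).2 hZ)

end Gauss

end Literature.MathematicalPhysics.QuantumFieldTheory.Balaban1983to89.B9Eq320Gauss
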